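import Summits.AnomalousDissipation.AnomalousDissipation.Theorems.BaireTransferDenseLoudDesignerForcesHomoclinicLine
import Literature.Dynamics.Hyperbolic.ChowLinPalmerShadowing
import Mathlib.Analysis.Normed.Lp.lpSpace
import Mathlib.Topology.MetricSpace.Thickening

/-!
# ENGINE vocabulary of the line `homoclinic-excursion-trains`: the polysection package of a homoclinic loop
# (crux `BaireTransfer.DenseLoudDesignerForces`, stmt-AnomalousDissipation-1143)

Definitions-only support file + sorry-free combinatorics for the RESHAPED engine of the line (lead -1, 2026-08-16,
after wave 1; decomposition designed by the wave-1 engine worker, scout v2, vetted by the lead).  The registered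
engine stub `stub_oneLoopTrains` (Smale–Birkhoff one-loop trains of a hyperbolic transverse homoclinic loop of
NS_ν) is split at the skeleton level into

* the ABSTRACT LAYER (Literature, no PDE): the Chow–Lin–Palmer shadowing lemma `ChowLinPalmerShadowing`
  (named fact, `Literature/Dynamics/Hyperbolic/ChowLinPalmerShadowing.lean`) and two-sided exponential tracking
  near a CLP hyperbolic set (`IsCLPHyperbolicSet.exists_tracksWith`, PROVED,
  `Literature/Dynamics/Hyperbolic/HyperbolicTracking.lean`);
* the NS_ν DICTIONARY, three registered stubs over the vocabulary of THIS file: D1a existence of the polysection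
  package (`SectionPackage`), D1b–d the loop `{p₀} ∪ {q_n}` is a CLP hyperbolic set of the polysection map, D2′ a
  periodic polysection orbit shadowing the one-loop pseudo-orbit with two-sided geometric decay is a one-loop
  train (gluing + phase bookkeeping);

glued by `engine_glue` (registered sub-goal, file `…HomoclinicEngineGlue.lean`).  This file: the section model
`Sec = ℓ²(ℕ;ℝ)`, the structure `SectionPackage ν F uP τP uΓ` (polysection map `ψ`, radius of honesty `r`, base
point `p₀`, crossings `q`, chart, crossing times `tq`, transit times `ret`, local classical solutions `sol/pres`
with continuous dependence — exactly the data D2′ consumes), the loop set, the ONE-LOOP PSEUDO-ORBIT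
`…, p₀, q₋N, …, q_N, p₀ (m times), …` of period `2N+1+m` and its proved combinatorics (`isPseudoOrbit_pseudoOrbit`:
jumps `≤ ‖q_{N+1} − p₀‖ + ‖q_{−N} − p₀‖`; `pseudoOrbit_excursion/_dwell`: reading one period).  No facts asserted.

References: Hale–Lin 1986 §8 (Poincaré maps of semiflows), Pilyugin1999 §1.3.4; the line card
`Cruxes/DenseLoudDesignerForces/Lines/homoclinic-excursion-trains.md`; scout report (item evidence wave1-report.md).
-/

-- `Summit.<Summit>.<Problem>` is the tree's mandated summit-side namespace (CONVENTIONS §2); for this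
-- single-conjunct summit the two coincide, so the duplicate is deliberate.
set_option linter.dupNamespace false

noncomputable section

open scoped BigOperators Topology
open Filter Set Function TopologicalSpace MeasureTheory Metric

namespace Summit.AnomalousDissipation.AnomalousDissipation.Theorems.DenseLoudDesignerForces.Homoclinic

open Literature.Analysis.FunctionSpaces Literature.Analysis.FunctionSpaces.Torus
open Literature.Analysis.FluidPDE
open Summit.AnomalousDissipation.AnomalousDissipation.Theses.BaireTransfer
open Summit.AnomalousDissipation.AnomalousDissipation.Theorems.DenseLoudDesignerForces.Negative
open Literature.Dynamics.Hyperbolic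

/-- The flat unit torus `T³`. -/
local notation "𝕋³" => UnitAddTorus (Fin 3)
/-- Real velocity values. -/
local notation "ℝ³" => EuclideanSpace ℝ (Fin 3)

/-! ## §1 The section model and the polysection package -/

/-- The model of every section: `ℓ²(ℕ; ℝ)` (every closed affine hyperplane of the mean slice of `H¹_σ(T³)`,
and every finite disjoint union of such read in far-apart balls, is isometric to an (affine) subset of it). -/
abbrev Sec : Type := lp (fun _ : ℕ => ℝ) 2

/-- **The POLYSECTION PACKAGE of a homoclinic loop (data + the properties the gluing stub D2′ consumes; its
EXISTENCE is the registered stub D1a `stub_sectionPackage`).**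
`ψ` is the polysection map of the NS_ν(F) semiflow near the loop `P ∪ Γ`, read in `ℓ²`: a codimension-one
affine section `Σ_P ∋ u_P(0)` of the slice `{∫u = ∫u_P}` of `H¹_σ`, transversal to `∂ₜu_P(0) ≠ 0`
(`nonsteady` + backward uniqueness), finitely many local sections `Σ₁,…,Σ_J` along the excursion proper, all
charted isometrically into pairwise far-apart balls of `ℓ²`; `ψ` = first return to `Σ_P` near the tails of the
loop, = transit to the next section along the excursion, globally `C¹`-extended off the `r`-neighbourhood of
the loop (smooth cut-off in Hilbert space).  `ret` = transit time, `sol s` = the classical solution issued from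
`chart s`, `q n` / `tq n` = the successive crossings of `u_Γ` and their times, `p₀ ↔ u_P(0)`. -/
structure SectionPackage (ν : ℝ) (F : 𝕋³ → ℝ³) (uP : ℝ → 𝕋³ → ℝ³) (τP : ℝ) (uΓ : ℝ → 𝕋³ → ℝ³) where
  /-- the polysection map (globally `C¹`; honest on the `r`-neighbourhood of the loop) -/
  ψ : Sec → Sec
  contDiff : ContDiff ℝ 1 ψ
  /-- radius of honesty -/
  r : ℝ
  r_pos : 0 < r
  /-- base point `↔ u_P(0)` and the crossings of the excursion -/
  p₀ : Sec
  q : ℤ → Sec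
  fixed : ψ p₀ = p₀
  q_orbit : IsOrbit ψ q
  q_top : Tendsto (fun n : ℕ => q n) atTop (𝓝 p₀)
  q_bot : Tendsto (fun n : ℕ => q (-(n : ℤ))) atTop (𝓝 p₀)
  /-- chart: section point ↦ velocity field (an affine isometry of each section piece for the `H¹` distance,
  composed with the nearest-piece projection; only an anchor here — closeness is transported by `sol_lipschitz`
  at positive times, where all fields are smooth and `h1DistSq` is honest) -/
  chart : Sec → 𝕋³ → ℝ³
  chart_p₀ : chart p₀ = uP 0
  /-- crossing times of the excursion: strictly increasing, exhausting `ℝ` -/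
  tq : ℤ → ℝ
  tq_strictMono : StrictMono tq
  tq_top : Tendsto tq atTop atTop
  tq_bot : Tendsto tq atBot atBot
  chart_q : ∀ n, chart (q n) = uΓ (tq n)
  /-- transit times: Lipschitz near the loop, a period of the base at `p₀`, consistent with `tq` -/
  ret : Sec → ℝ
  ret_pos : ∀ s ∈ cthickening r (insert p₀ (range q)), 0 < ret s
  ret_lipschitz : ∃ L, LipschitzOnWith L ret (cthickening r (insert p₀ (range q)))
  base_periodic : Function.Periodic uP (ret p₀)
  ret_p₀_pos : 0 < ret p₀
  ret_p₀_dvd : ∃ k : ℕ, τP = k * ret p₀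
  tq_succ : ∀ n, tq (n + 1) = tq n + ret (q n)
  /-- local solutions issued from section points (`H¹` data: classical for POSITIVE times by parabolic
  smoothing, `L²`-continuous at `t = 0`), realising `ψ` at the transit time -/
  sol : Sec → ℝ → 𝕋³ → ℝ³
  pres : Sec → ℝ → 𝕋³ → ℝ
  sol_isSolution : ∀ s ∈ cthickening r (insert p₀ (range q)),
    IsClassicalNSSolutionOn (Ioc 0 (ret s + r)) ν (fun _ => F) (sol s) (pres s)
  sol_tendsto_zero : ∀ s ∈ cthickening r (insert p₀ (range q)),
    Tendsto (fun t => ∫ x, ‖sol s t x - chart s x‖ ^ 2) (𝓝[>] 0) (𝓝 0)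
  sol_ret : ∀ s ∈ cthickening r (insert p₀ (range q)), sol s (ret s) = chart (ψ s)
  sol_p₀ : ∀ t ∈ Icc 0 (ret p₀ + r), sol p₀ t = uP t
  sol_q : ∀ n, ∀ t ∈ Icc 0 (ret (q n) + r), sol (q n) t = uΓ (tq n + t)
  /-- continuous dependence in `H¹` over one transit, at positive times (uniform constant near the loop) -/
  sol_lipschitz : ∃ K, ∀ s ∈ cthickening r (insert p₀ (range q)), ∀ s' ∈ ball s r,
    ∀ t ∈ Ioc 0 (ret s + r), h1DistSq (sol s t) (sol s' t) ≤ K * ‖s - s'‖ ^ 2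
  /-- the loop fields are `H¹`-Lipschitz in time (bounded eternal classical solutions) -/
  time_lipschitz : ∃ K, ∀ t t', h1DistSq (uΓ t) (uΓ t') ≤ K * (t - t') ^ 2 ∧
    h1DistSq (uP t) (uP t') ≤ K * (t - t') ^ 2

namespace SectionPackage

variable {ν : ℝ} {F : 𝕋³ → ℝ³} {uP : ℝ → 𝕋³ → ℝ³} {τP : ℝ} {uΓ : ℝ → 𝕋³ → ℝ³}

/-- The loop set `Λ = {p₀} ∪ {q_n}` in the polysection. [folklore] -/
def loop (pkg : SectionPackage ν F uP τP uΓ) : Set Sec := insert pkg.p₀ (range pkg.q)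

/-- The period `2N + 1 + m` of the one-loop pseudo-orbit. [folklore] -/
def period (Nc m : ℕ) : ℤ := ((2 * Nc + 1 + m : ℕ) : ℤ)

/-- One period of the one-loop pseudo-orbit, read on `[0, 2N+1+m)`: `q_{j−N}` for `j ≤ 2N`, then `p₀`. [folklore] -/
def loopSeq (pkg : SectionPackage ν F uP τP uΓ) (Nc : ℕ) (j : ℤ) : Sec :=
  if j ≤ 2 * Nc then pkg.q (j - Nc) else pkg.p₀

/-- **The one-loop pseudo-orbit** `…, p₀, q₋N, …, q_N, p₀, … (m times), q₋N, …`, period `2N+1+m`. [folklore] -/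
def pseudoOrbit (pkg : SectionPackage ν F uP τP uΓ) (Nc m : ℕ) (k : ℤ) : Sec :=
  pkg.loopSeq Nc (k % period Nc m)

/-! ## §2 Proved combinatorics of the one-loop pseudo-orbit -/

/-- The period is positive. [folklore] -/
theorem period_pos (Nc m : ℕ) : 0 < period Nc m := by
  unfold period; positivity

/-- `p₀ ∈ Λ`. [folklore] -/
theorem p₀_mem_loop (pkg : SectionPackage ν F uP τP uΓ) : pkg.p₀ ∈ pkg.loop := mem_insert _ _

/-- `q_n ∈ Λ`. [folklore] -/
theorem q_mem_loop (pkg : SectionPackage ν F uP τP uΓ) (n : ℤ) : pkg.q n ∈ pkg.loop :=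
  mem_insert_of_mem _ (mem_range_self n)

/-- One period of the pseudo-orbit lies in `Λ`. [folklore] -/
theorem loopSeq_mem_loop (pkg : SectionPackage ν F uP τP uΓ) (Nc : ℕ) (j : ℤ) :
    pkg.loopSeq Nc j ∈ pkg.loop := by
  unfold loopSeq; split_ifs
  · exact pkg.q_mem_loop _
  · exact pkg.p₀_mem_loop

/-- The pseudo-orbit lies in `Λ`. [folklore] -/
theorem pseudoOrbit_mem_loop (pkg : SectionPackage ν F uP τP uΓ) (Nc m : ℕ) (k : ℤ) :
    pkg.pseudoOrbit Nc m k ∈ pkg.loop :=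
  pkg.loopSeq_mem_loop Nc _

/-- The pseudo-orbit is `period`-periodic. [folklore] -/
theorem pseudoOrbit_add_period (pkg : SectionPackage ν F uP τP uΓ) (Nc m : ℕ) (k : ℤ) :
    pkg.pseudoOrbit Nc m (k + period Nc m) = pkg.pseudoOrbit Nc m k := by
  unfold pseudoOrbit
  rw [show k + period Nc m = k + period Nc m * 1 by ring, Int.add_mul_emod_self_left]

/-- `(k+1) % M = k % M + 1` away from the wrap. [folklore] -/
theorem emod_succ_of_lt {k M : ℤ} (hM : 0 < M) (h : k % M + 1 < M) : (k + 1) % M = k % M + 1 := by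
  have e : k + 1 = (k % M + 1) + M * (k / M) := by have := Int.emod_def k M; linarith
  rw [e, Int.add_mul_emod_self_left]
  exact Int.emod_eq_of_lt (by have := Int.emod_nonneg k hM.ne'; linarith) h

/-- `(k+1) % M = 0` at the wrap. [folklore] -/
theorem emod_succ_of_eq {k M : ℤ} (h : k % M + 1 = M) : (k + 1) % M = 0 := by
  have e : k + 1 = (k % M + 1) + M * (k / M) := by have := Int.emod_def k M; linarith
  rw [e, Int.add_mul_emod_self_left, h, Int.emod_self]

/-- **Registered anchor sub-goal.** The jumps of the one-loop pseudo-orbit (dwell `m ≥ 1`) are at most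
`‖q_{N+1} − p₀‖ + ‖q_{−N} − p₀‖`. [folklore] -/
theorem isPseudoOrbit_pseudoOrbit {ν : ℝ} {F : 𝕋³ → ℝ³} {uP : ℝ → 𝕋³ → ℝ³} {τP : ℝ} {uΓ : ℝ → 𝕋³ → ℝ³} (pkg : SectionPackage ν F uP τP uΓ) (Nc m : ℕ) (hm : 1 ≤ m) : IsPseudoOrbit pkg.ψ (‖pkg.q (Nc + 1) - pkg.p₀‖ + ‖pkg.q (-(Nc : ℤ)) - pkg.p₀‖) (pkg.pseudoOrbit Nc m) := by
  intro k
  have hM := period_pos Nc m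
  set M : ℤ := period Nc m with hMdef
  have hMval : M = 2 * Nc + 1 + m := by rw [hMdef]; unfold period; push_cast; ring
  set j : ℤ := k % M with hj
  have hj0 : 0 ≤ j := Int.emod_nonneg k hM.ne'
  have hjM : j < M := Int.emod_lt_of_pos k hM
  have hA : 0 ≤ ‖pkg.q (Nc + 1) - pkg.p₀‖ := norm_nonneg _
  have hB : 0 ≤ ‖pkg.q (-(Nc : ℤ)) - pkg.p₀‖ := norm_nonneg _
  unfold pseudoOrbit
  rw [← hMdef, ← hj]
  by_cases hlast : j + 1 = M
  · -- last dwell symbol: `p₀ ↦ q_{−N}`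
    rw [emod_succ_of_eq (by rw [← hj]; exact hlast)]
    have h1 : pkg.loopSeq Nc j = pkg.p₀ := by
      unfold loopSeq; rw [if_neg]; omega
    have h2 : pkg.loopSeq Nc 0 = pkg.q (-(Nc : ℤ)) := by
      unfold loopSeq; rw [if_pos (by positivity)]; simp
    rw [h1, h2, pkg.fixed, ← norm_neg, neg_sub]
    linarith
  · have hlt : j + 1 < M := lt_of_le_of_ne (by omega) hlast
    rw [emod_succ_of_lt hM (by rw [← hj]; exact hlt)]
    by_cases hexc : j < 2 * Nc
    · -- inside the excursion: no jump
      have h1 : pkg.loopSeq Nc j = pkg.q (j - Nc) := by unfold loopSeq; rw [if_pos (by omega)]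
      have h2 : pkg.loopSeq Nc (j + 1) = pkg.q (j - Nc + 1) := by
        unfold loopSeq; rw [if_pos (by omega)]; congr 1; ring
      rw [h1, h2, pkg.q_orbit (j - Nc), sub_self, norm_zero]
      positivity
    · by_cases hend : j = 2 * Nc
      · -- end of the excursion: `q_N ↦ p₀`
        have h1 : pkg.loopSeq Nc j = pkg.q Nc := by
          unfold loopSeq; rw [if_pos (by omega)]; congr 1; omega
        have h2 : pkg.loopSeq Nc (j + 1) = pkg.p₀ := by unfold loopSeq; rw [if_neg (by omega)]
        rw [h1, h2, pkg.q_orbit (Nc : ℤ)]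
        linarith
      · -- inside the dwell: no jump
        have h1 : pkg.loopSeq Nc j = pkg.p₀ := by unfold loopSeq; rw [if_neg (by omega)]
        have h2 : pkg.loopSeq Nc (j + 1) = pkg.p₀ := by unfold loopSeq; rw [if_neg (by omega)]
        rw [h1, h2, pkg.fixed, sub_self, norm_zero]
        positivity

/-! ## §3 Reading one period of the pseudo-orbit -/

/-- On `[0, 2N]` the pseudo-orbit reads the excursion crossings `q_{i−N}`. [folklore] -/
theorem pseudoOrbit_excursion (pkg : SectionPackage ν F uP τP uΓ) (Nc m : ℕ) {i : ℕ} (hi : i ≤ 2 * Nc) :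
    pkg.pseudoOrbit Nc m i = pkg.q ((i : ℤ) - Nc) := by
  unfold pseudoOrbit
  have hM : ((i : ℤ)) % period Nc m = i :=
    Int.emod_eq_of_lt (by positivity) (by unfold period; push_cast; omega)
  rw [hM]
  unfold loopSeq
  rw [if_pos (by exact_mod_cast hi)]

/-- On `[2N+1, 2N+1+m)` the pseudo-orbit dwells at `p₀`. [folklore] -/
theorem pseudoOrbit_dwell (pkg : SectionPackage ν F uP τP uΓ) (Nc m : ℕ) {i : ℕ} (hi : i < m) :
    pkg.pseudoOrbit Nc m ((2 * Nc + 1 + i : ℕ) : ℤ) = pkg.p₀ := by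
  unfold pseudoOrbit
  have hM : (((2 * Nc + 1 + i : ℕ) : ℤ)) % period Nc m = ((2 * Nc + 1 + i : ℕ) : ℤ) :=
    Int.emod_eq_of_lt (by positivity) (by unfold period; push_cast; omega)
  rw [hM]
  unfold loopSeq
  rw [if_neg (by push_cast; omega)]

end SectionPackage

end Summit.AnomalousDissipation.AnomalousDissipation.Theorems.DenseLoudDesignerForces.Homoclinic

end
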